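import Summits.QuantumFields.YangMills.Theorems.BalabanLadderUVSeamRecColdWallKernelMeanPolyWindow
import Summits.QuantumFields.YangMills.Theorems.BalabanLadderNTBoundaryLawCore
import Literature.MathematicalPhysics.QuantumLattice.RepLieAlgebraUnitary
import HarnessLib

/-!
# Crux `UVSeamRec` (stmt-QuantumFields-20043), line «coldwall_pure»: the cold-wall ceiling IN THE CRUX'S LETTERS —
# `kerE^𝟙_{β,(x−R−1, 2R+3)}(2 − plane q x) ≤ 5/(2β)` UNIFORMLY for `R + 1 ≤ ⌈β^{1/100}⌉`, and its semiclassical value `(3/2)·C_{D,R+1}/β ± β^{−1−θ}`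

Helper file (`--supports stmt-QuantumFields-20043`) of the LEAD seat `ym-spine-20043-p1` (gen 14); sequel of `…ColdWallKernelMeanPolyWindow`
(`coldWall_kernelMean_sub_le`: the cold-wall kernel mean of the plaquette deficit in EVERY box `1 ≤ H ≤ ⌈β^θ⌉` is `(3/2)·boxDirProjKernel H q q`
up to `β^{−θ}`, in the vocabulary of the route `WeakCouplingRates`: `boxState`, `plaqCostAt`, `boxEdges 4 (2H+1)`).  This file is the DICTIONARY
to the letters of the registered line `Lines/coldwall_pure.lean` (stubs `stub_dirichletRate` (DR), `stub_coldWallSplit` (CW)): the cube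
`(x − R − 1, 2R + 3)` of `kerE` is the translate by `x − (R+1)·𝟙` of the route's box `[0, 2(R+1)]⁴` (`cubeEdges 0 n = boxEdges 4 n`,
`kerE_configShift`, `configShift_one`, `plane_configShift`), `2 − plane q y = plaqCostAt ρ_F y q.1 q.2` (`plane_eq_plaquetteObs`), and the
centre plaquette touches the box.  Results (`SU(2)`, fundamental representation, identity exterior, `0 < θ ≤ 1/100`, eventually in `β`, for ALL
`R` with `R + 1 ≤ ⌈β^θ⌉`, every plane `q.1 < q.2`, every site `x`):
* `kerE_one_eq_integral_boxState` — the dictionary identity;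
* **`kerE_one_deficit_semiclassical_polyWindow`** — `|β·kerE^𝟙_{β,(x−R−1,2R+3)}(2 − plane q x) − (3/2)·C_{D,R+1}| ≤ β^{−θ}`,
  `C_{D,R+1} = boxDirProjKernel (R+1) ((R+1)·𝟙, q) ((R+1)·𝟙, q) ∈ [0, 1]` the lattice-Maxwell Dirichlet (conducting-cavity) variance of the centre
  plaquette — the LEADING ORDER of (DR) ∕ the zeroth order of (CW), on the polynomial window;
* `tendsto_mul_kerE_one_deficit` (§3, appended) — the FIXED-cube one-loop LIMIT `β·kerE^𝟙(2 − plane q x) → (3/2)·C_{D,R+1}` (every `R`);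
* **`kerE_one_deficit_le_polyWindow`** — `kerE^𝟙_{β,(x−R−1,2R+3)}(2 − plane q x) ≤ 5/(2β)`: director-ym R394 (a) item (1) — the pointwise
  cold-wall ceiling UNIFORM IN THE BOX — on the polynomial window `R + 1 ≤ ⌈β^{1/100}⌉` (gens 11–12: box average 92/β in every cube; fixed-`R`
  pointwise with constant `∝ (2R+3)⁴`; `R`-uniform pointwise located as CWX-hard — which it remains on the femto window `R ≤ ℓ/uRec β`).
HONEST FRAMING: a dictionary on top of the route `WeakCouplingRates`' one-scale expansion; the femto window of (DR)/(CW) is untouched; nothing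
of E0′, NT or the gap; YM mass gap NOT proved; not Clay.
-/

set_option autoImplicit false

noncomputable section

open MeasureTheory Finset Filter
open Literature.Probability.LatticeModels (Site)
open Literature.MathematicalPhysics.QuantumLattice
open Literature.MathematicalPhysics.QuantumFieldTheory
open Literature.MathematicalPhysics.QuantumFieldTheory.LatticeMaxwell
open Literature.MathematicalPhysics.QuantumFieldTheory.AxialGauge
open Summit.QuantumFields.YangMills.Theorems.WeakCouplingRates
open Summit.QuantumFields.YangMills.Cruxes.OSLegsFromFemtoAndGap.DlrCollarTransfer (cubeSites cubeEdges kerE plane)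
open Summit.QuantumFields.YangMills.Cruxes.NT.BoundaryLaw (kerE_configShift plane_configShift plane_eq_plaquetteObs)

namespace Summit.QuantumFields.YangMills.Cruxes.UVSeamRec.ClassicalResponse.ColdWall

/-! ### §1 The dictionary: the crux's cube kernels at the origin are the route's box states -/

/-- `cubeSites 0 n = halfOpenBox 4 n`. [folklore] -/
theorem cubeSites_zero (n : ℕ) : cubeSites 0 n = Literature.Probability.LatticeModels.halfOpenBox 4 n := by
  ext x
  simp [cubeSites, Literature.Probability.LatticeModels.halfOpenBox, Fintype.mem_piFinset]

/-- `cubeEdges 0 n = boxEdges 4 n`: the crux's cube at the origin is the route's box `[0, n)⁴`. [folklore] -/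
theorem cubeEdges_zero (n : ℕ) : cubeEdges 0 n = boxEdges 4 n := by
  ext e
  rw [cubeEdges, mem_boxEdges, Finset.mem_filter, Finset.mem_product, cubeSites_zero]
  simp

/-- **The dictionary identity.**  For the fundamental representation of `SU(2)`, the crux's kernel `kerE` of the cube `(0, 2R+3)` with the
identity exterior is integration against the route's cold-wall box state of half-side `R + 1`. [folklore] -/
theorem kerE_one_eq_integral_boxState (β : ℝ) (R : ℕ) (F : LGConfig 4 (Matrix.specialUnitaryGroup (Fin 2) ℂ) → ℝ) :
    kerE (Matrix.specialUnitaryGroup (Fin 2) ℂ) (fundamentalLatticeRep 2) β 0 (2 * R + 3) 1 F =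
      ∫ U, F U ∂(boxState (fundamentalRep (Fin 2)) β (R + 1)) := by
  unfold kerE boxState
  rw [cubeEdges_zero, show 2 * (R + 1) + 1 = 2 * R + 3 by ring]
  rfl

/-- The translated cube: the kernel mean of the deficit `2 − plane q x` in the cube `(x − R − 1, 2R + 3)` with the identity exterior equals the
kernel mean of `2 − plane q ((R+1)·𝟙)` in the cube `(0, 2R+3)`. [folklore] -/
theorem kerE_one_two_sub_plane_eq_origin (β : ℝ) (R : ℕ) (q : Fin 4 × Fin 4) (x : Fin 4 → ℤ) :
    kerE (Matrix.specialUnitaryGroup (Fin 2) ℂ) (fundamentalLatticeRep 2) β (fun k => x k - (R + 1)) (2 * R + 3) 1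
        (fun U => 2 - plane (Matrix.specialUnitaryGroup (Fin 2) ℂ) (fundamentalLatticeRep 2) q x U) =
      kerE (Matrix.specialUnitaryGroup (Fin 2) ℂ) (fundamentalLatticeRep 2) β 0 (2 * R + 3) 1
        (fun U => 2 - plane (Matrix.specialUnitaryGroup (Fin 2) ℂ) (fundamentalLatticeRep 2) q (fun _ => (R : ℤ) + 1) U) := by
  have h1 : configShift (fun k => x k - ((R : ℤ) + 1)) (1 : LGConfig 4 (Matrix.specialUnitaryGroup (Fin 2) ℂ)) = 1 := by
    funext e; rw [Literature.MathematicalPhysics.QuantumLattice.configShift_apply]; rfl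
  have hF : ((fun U => 2 - plane (Matrix.specialUnitaryGroup (Fin 2) ℂ) (fundamentalLatticeRep 2) q x U) ∘
        configShift (fun k => x k - ((R : ℤ) + 1))) =
      fun U => 2 - plane (Matrix.specialUnitaryGroup (Fin 2) ℂ) (fundamentalLatticeRep 2) q (fun _ => (R : ℤ) + 1) U := by
    funext U
    have hx : ((fun _ : Fin 4 => (R : ℤ) + 1) + fun k => x k - ((R : ℤ) + 1)) = x := by
      funext k; simp only [Pi.add_apply]; ring
    have hp := plane_configShift (Matrix.specialUnitaryGroup (Fin 2) ℂ) (fundamentalLatticeRep 2) (fun k => x k - ((R : ℤ) + 1)) q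
      (fun _ : Fin 4 => (R : ℤ) + 1) U
    rw [hx] at hp
    rw [Function.comp_apply, hp]
  have h := kerE_configShift (Matrix.specialUnitaryGroup (Fin 2) ℂ) (fundamentalLatticeRep 2) (fun k => x k - ((R : ℤ) + 1)) β 0
    (2 * R + 3) 1 (fun U => 2 - plane (Matrix.specialUnitaryGroup (Fin 2) ℂ) (fundamentalLatticeRep 2) q x U)
  rw [zero_add, h1, hF] at h
  exact h

/-- `2 − plane q y` is the route's plaquette cost at `y` in the plane `q` (fundamental `SU(2)`, `N = 2`). [folklore] -/
theorem two_sub_plane_eq_plaqCostAt (q : Fin 4 × Fin 4) (y : Fin 4 → ℤ) (U : LGConfig 4 (Matrix.specialUnitaryGroup (Fin 2) ℂ)) :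
    2 - plane (Matrix.specialUnitaryGroup (Fin 2) ℂ) (fundamentalLatticeRep 2) q y U = plaqCostAt (fundamentalRep (Fin 2)) y q.1 q.2 U := by
  rw [plane_eq_plaquetteObs, plaqCostAt]
  norm_num
  rfl

/-- The centre plaquette of the box `[0, 2(R+1)]⁴` touches it. [folklore] -/
theorem centre_mem_plaquettesTouching (R : ℕ) (q : Fin 4 × Fin 4) (hq : q.1 < q.2) :
    (((fun _ : Fin 4 => (R : ℤ) + 1), ⟨(q.1, q.2), hq⟩) : ZdPlaquette 4) ∈ plaquettesTouching (boxEdges 4 (2 * (R + 1) + 1)) := by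
  rw [mem_plaquettesTouching_iff]
  refine ⟨((fun _ : Fin 4 => (R : ℤ) + 1), q.1), Finset.mem_inter.2 ⟨by simp [plaquetteEdges], ?_⟩⟩
  rw [mem_boxEdges, Literature.Probability.LatticeModels.mem_halfOpenBox, Literature.Probability.LatticeModels.mem_halfOpenBox]
  refine ⟨fun k => ⟨by positivity, by push_cast; omega⟩, fun k => ?_⟩
  rw [Pi.add_apply, Pi.single_apply]
  split_ifs <;> constructor <;> push_cast <;> omega

/-! ### §2 The cold-wall centre deficit on the polynomial window, in the crux's letters -/

/-- **THE SEMICLASSICAL VALUE OF THE COLD-WALL CENTRE DEFICIT ON THE POLYNOMIAL WINDOW** (crux letters).  For `0 < θ ≤ 1/100` there is `β₀`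
such that for all `β ≥ β₀`, all `R` with `R + 1 ≤ ⌈β^θ⌉`, every plane `q.1 < q.2` and every site `x`:
`|β · kerE^𝟙_{β,(x−R−1,2R+3)}(2 − plane q x) − (3/2)·boxDirProjKernel (R+1) ((R+1)·𝟙,q) ((R+1)·𝟙,q)| ≤ β^{−θ}`. [folklore] -/
theorem kerE_one_deficit_semiclassical_polyWindow {θ : ℝ} (hθ : 0 < θ) (hθ₂ : θ ≤ 1 / 100) :
    ∃ β₀ : ℝ, ∀ β : ℝ, β₀ ≤ β → ∀ R : ℕ, R + 1 ≤ ⌈β ^ θ⌉₊ → ∀ (q : Fin 4 × Fin 4) (x : Fin 4 → ℤ), q.1 < q.2 →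
      |β * kerE (Matrix.specialUnitaryGroup (Fin 2) ℂ) (fundamentalLatticeRep 2) β (fun k => x k - (R + 1)) (2 * R + 3) 1
            (fun U => 2 - plane (Matrix.specialUnitaryGroup (Fin 2) ℂ) (fundamentalLatticeRep 2) q x U) -
          3 / 2 * boxDirProjKernel (R + 1) ((fun _ : Fin 4 => (R : ℤ) + 1), q.1, q.2) ((fun _ : Fin 4 => (R : ℤ) + 1), q.1, q.2)| ≤
        β ^ (-θ) := by
  obtain ⟨β₀, h⟩ := coldWall_kernelMean_sub_le hθ hθ₂
  refine ⟨β₀, fun β hβ R hR q x hq => ?_⟩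
  rw [kerE_one_two_sub_plane_eq_origin, kerE_one_eq_integral_boxState]
  simp_rw [two_sub_plane_eq_plaqCostAt]
  exact h β hβ (R + 1) (by omega) hR (fun _ => (R : ℤ) + 1) q.1 q.2 hq (centre_mem_plaquettesTouching R q hq)

/-- **THE COLD-WALL CEILING, UNIFORMLY ON THE POLYNOMIAL WINDOW** (director-ym R394 (a) item (1) on `R + 1 ≤ ⌈β^{1/100}⌉`; crux letters).
For `0 < θ ≤ 1/100` there is `β₀ > 0` such that for all `β ≥ β₀`, all `R` with `R + 1 ≤ ⌈β^θ⌉`, every plane `q.1 < q.2`, every site `x`: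
`kerE^𝟙_{β,(x−R−1,2R+3)}(2 − plane q x) ≤ 5/(2β)`. [folklore] -/
theorem kerE_one_deficit_le_polyWindow {θ : ℝ} (hθ : 0 < θ) (hθ₂ : θ ≤ 1 / 100) :
    ∃ β₀ : ℝ, 0 < β₀ ∧ ∀ β : ℝ, β₀ ≤ β → ∀ R : ℕ, R + 1 ≤ ⌈β ^ θ⌉₊ → ∀ (q : Fin 4 × Fin 4) (x : Fin 4 → ℤ), q.1 < q.2 →
      kerE (Matrix.specialUnitaryGroup (Fin 2) ℂ) (fundamentalLatticeRep 2) β (fun k => x k - (R + 1)) (2 * R + 3) 1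
          (fun U => 2 - plane (Matrix.specialUnitaryGroup (Fin 2) ℂ) (fundamentalLatticeRep 2) q x U) ≤ 5 / (2 * β) := by
  obtain ⟨β₀, hβ₀, h⟩ := coldWall_kernelMean_le hθ hθ₂
  refine ⟨β₀, hβ₀, fun β hβ R hR q x hq => ?_⟩
  rw [kerE_one_two_sub_plane_eq_origin, kerE_one_eq_integral_boxState]
  simp_rw [two_sub_plane_eq_plaqCostAt]
  exact h β hβ (R + 1) (by omega) hR (fun _ => (R : ℤ) + 1) q.1 q.2 hq (centre_mem_plaquettesTouching R q hq)

/-- The FLOOR reading in the crux's letters: `β · kerE^𝟙(2 − plane q x) ≥ (3/2)·C_{D,R+1} − β^{−θ}` on the polynomial window. [folklore] -/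
theorem kerE_one_deficit_ge_polyWindow {θ : ℝ} (hθ : 0 < θ) (hθ₂ : θ ≤ 1 / 100) :
    ∃ β₀ : ℝ, ∀ β : ℝ, β₀ ≤ β → ∀ R : ℕ, R + 1 ≤ ⌈β ^ θ⌉₊ → ∀ (q : Fin 4 × Fin 4) (x : Fin 4 → ℤ), q.1 < q.2 →
      3 / 2 * boxDirProjKernel (R + 1) ((fun _ : Fin 4 => (R : ℤ) + 1), q.1, q.2) ((fun _ : Fin 4 => (R : ℤ) + 1), q.1, q.2) - β ^ (-θ) ≤
        β * kerE (Matrix.specialUnitaryGroup (Fin 2) ℂ) (fundamentalLatticeRep 2) β (fun k => x k - (R + 1)) (2 * R + 3) 1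
            (fun U => 2 - plane (Matrix.specialUnitaryGroup (Fin 2) ℂ) (fundamentalLatticeRep 2) q x U) := by
  obtain ⟨β₀, h⟩ := kerE_one_deficit_semiclassical_polyWindow hθ hθ₂
  refine ⟨β₀, fun β hβ R hR q x hq => ?_⟩
  have hm := (abs_le.1 (h β hβ R hR q x hq)).1
  linarith [hm]

/-! ### §3 The fixed-cube semiclassical LIMIT (appended, LEAD g14) -/

/-- **THE FIXED-CUBE ONE-LOOP LIMIT** (corollary of the polynomial-window expansion: a fixed `R` lies in the window eventually): for every `R`,
every plane `q.1 < q.2` and site `x`, `β · kerE^𝟙_{β,(x−R−1,2R+3)}(2 − plane q x) → (3/2)·C_{D,R+1}(centre, q)` as `β → ∞` — the lattice-Maxwell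
Dirichlet (conducting-cavity) value of the cube.  (This is the statement the abstract Laplace engine `…SemiclassicalLaplace` was written for; the
route `WeakCouplingRates`' expansion gives it with a rate.) [folklore] -/
theorem tendsto_mul_kerE_one_deficit (R : ℕ) (q : Fin 4 × Fin 4) (x : Fin 4 → ℤ) (hq : q.1 < q.2) :
    Tendsto (fun β : ℝ => β * kerE (Matrix.specialUnitaryGroup (Fin 2) ℂ) (fundamentalLatticeRep 2) β (fun k => x k - (R + 1)) (2 * R + 3) 1
        (fun U => 2 - plane (Matrix.specialUnitaryGroup (Fin 2) ℂ) (fundamentalLatticeRep 2) q x U)) atTop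
      (nhds (3 / 2 * boxDirProjKernel (R + 1) ((fun _ : Fin 4 => (R : ℤ) + 1), q.1, q.2) ((fun _ : Fin 4 => (R : ℤ) + 1), q.1, q.2))) := by
  obtain ⟨β₀, h⟩ := kerE_one_deficit_semiclassical_polyWindow (θ := 1 / 100) (by norm_num) (by norm_num)
  rw [Metric.tendsto_atTop]
  intro ε hε
  -- eventually `β^{−1/100} < ε` and `R + 1 ≤ ⌈β^{1/100}⌉`
  have h1 : ∀ᶠ β : ℝ in atTop, β ^ (-(1 / 100 : ℝ)) < ε :=
    (tendsto_rpow_neg_atTop (by norm_num : (0 : ℝ) < 1 / 100)).eventually (gt_mem_nhds hε)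
  have h2 : ∀ᶠ β : ℝ in atTop, ((R : ℝ) + 1) ≤ β ^ (1 / 100 : ℝ) :=
    (tendsto_rpow_atTop (by norm_num : (0 : ℝ) < 1 / 100)).eventually_ge_atTop _
  obtain ⟨b, hb⟩ := ((h1.and h2).and (eventually_ge_atTop β₀)).exists_forall_of_atTop
  refine ⟨b, fun β hβ => ?_⟩
  obtain ⟨⟨hε', hRβ⟩, hβ0⟩ := hb β hβ
  have hR : R + 1 ≤ ⌈β ^ (1 / 100 : ℝ)⌉₊ := by
    have : ((R + 1 : ℕ) : ℝ) ≤ (⌈β ^ (1 / 100 : ℝ)⌉₊ : ℝ) := by push_cast; exact hRβ.trans (Nat.le_ceil _)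
    exact_mod_cast this
  have hm := h β hβ0 R hR q x hq
  rw [Real.dist_eq]
  exact lt_of_le_of_lt hm hε'

end Summit.QuantumFields.YangMills.Cruxes.UVSeamRec.ClassicalResponse.ColdWall

end
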